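import Literature.NumberTheory.Automorphic.UnboundedDenominatorsLambdaProofs
import Literature.NumberTheory.Automorphic.UnboundedDenominatorsDilationProofs
import HarnessLib

/-!
# The unbounded denominators theorem (Calegari–Dimitrov–Tang) — (4.3.3): the dilates `λ(dτ)` lie in `M_{2d}`

PROOF-ONLY sequel (no definition, no named fact; D-0026) of `UnboundedDenominatorsFields.lean`
(`levelGens N`, `levelField N = M_N ⊗ ℂ`), `UnboundedDenominatorsLambdaProofs.lean` (`λ ∈ M_2` via
the forms `U⁶`, `W U⁵ ∈ M_12(Γ(2))` with integral `q₂`-expansions) and the dilation machinery of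
`UnboundedDenominatorsProofs.lean` §4.3 (`f(pτ)` is a modular form on `A⁻¹ Γ A ∩ SL₂(ℤ)` with
the expected `q`-expansion, `A = diag(p, 1)`). Source: F. Calegari, V. Dimitrov, Y. Tang, *The
unbounded denominators conjecture*, J. Amer. Math. Soc. **38** (2025), §4.2, display (4.3.3)
("The degree of `M_N` over `M_2` is equal to the degree of the modular curve `Y(N)` over `Y(2)`
… `[M_N : M_2] = ½ [Γ(2) : Γ(N)]`").

Towards the LOWER BOUND `[M_N : M_2] ≥ c N³` (the only direction Theorem 1.0.1 uses) one needs
elements of `M_N` with small stabilisers in `Γ(2)`. This file supplies the dilates of `λ`: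

* `Gamma_mul_le_conjGL` — `Γ(M d) ≤ A⁻¹ Γ(M) A ∩ SL₂(ℤ)` for `A = diag(d, 1)`;
* `exists_dilate_mem_levelGens` — the dilate `F(dτ)/Δᵐ` of a generator `F/Δᵐ` of `M_M`
  (`F ∈ M_{12m}(G)`, `G ⊇ Γ(M)`, `F ∈ ℤ⟦q_M⟧`) is a generator of `M_{M d}`;
* ★ `exists_modularLambda_dilate_mem_levelField` — **`λ(dτ) ∈ M_{2d}`**: the holomorphic function
  `τ ↦ λ(A • τ) = λ(dτ)` (an element of `𝓗`) lies in `levelField (2 d)`, as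
  `1 − (W U⁵)(dτ)/Δ ⁄ (U⁶)(dτ)/Δ`.

The companion facts (the stabiliser of `λ(dτ)` in `Γ(2)` forces `2d ∣ c`, deck rigidity
`ModularLambdaDeckRigidity.lean`) and the assembly of (4.3.3) are in the sequel files.

## References

* [CalegariDimitrovTang2025] F. Calegari, V. Dimitrov, Y. Tang, The unbounded denominators
  conjecture, J. Amer. Math. Soc. 38 (2025), no. 3, 627–702; arXiv:2109.09040. §4.2 (4.3.3).
-/

noncomputable section

namespace Literature.NumberTheory.Automorphic

open scoped MatrixGroups ModularForm Manifold
open UpperHalfPlane CongruenceSubgroup Matrix.SpecialLinearGroup ModularGroup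
open Literature.NumberTheory.ModularForms ModularLambda

namespace UnboundedDenominators

variable {d : ℕ} {A : GL (Fin 2) ℝ}

/-! ### §1. `Γ(M d) ≤ A⁻¹ Γ(M) A` -/

/-- The `GL₂(ℝ)` bookkeeping for `A = diag(d, 1)`: `A x = y A` as soon as `y₀₀ = x₀₀`,
`y₀₁ = d x₀₁`, `d y₁₀ = x₁₀`, `y₁₁ = x₁₁` (i.e. `y = A x A⁻¹`). [folklore] -/
private lemma diag_mul_mapGL_eq {y x : SL(2, ℤ)}
    (hA : (A : Matrix (Fin 2) (Fin 2) ℝ) = !![(d : ℝ), 0; 0, 1])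
    (h00 : y 0 0 = x 0 0) (h01 : y 0 1 = (d : ℤ) * x 0 1) (h10 : (d : ℤ) * y 1 0 = x 1 0)
    (h11 : y 1 1 = x 1 1) :
    A * mapGL ℝ x = mapGL ℝ y * A := by
  have r00 : ((y 0 0 : ℤ) : ℝ) = x 0 0 := by exact_mod_cast h00
  have r01 : ((y 0 1 : ℤ) : ℝ) = d * x 0 1 := by exact_mod_cast h01
  have r10 : (d : ℝ) * y 1 0 = x 1 0 := by exact_mod_cast h10
  have r11 : ((y 1 1 : ℤ) : ℝ) = x 1 1 := by exact_mod_cast h11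
  apply Units.ext
  simp only [Units.val_mul, mapGL, MonoidHom.coe_comp, Function.comp_apply, coe_GL_coe_matrix,
    map_apply_coe, RingHom.mapMatrix_apply, hA]
  ext i j
  fin_cases i <;> fin_cases j <;>
    simp only [Matrix.mul_apply, Fin.sum_univ_two, Matrix.map_apply, Matrix.of_apply,
      Matrix.cons_val', Matrix.cons_val_zero, Matrix.cons_val_one, Matrix.cons_val_fin_one,
      Matrix.empty_val', eq_intCast, Fin.zero_eta, Fin.mk_one, Fin.isValue]
  · linear_combination (-(d : ℝ)) * r00
  · linear_combination -r01
  · linear_combination -r10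
  · linear_combination -r11

/-- **`Γ(M d) ≤ A⁻¹ Γ(M) A ∩ SL₂(ℤ)`** for `A = diag(d, 1)`: for `x ∈ Γ(M d)` the matrix
`A x A⁻¹ = [x₀₀, d x₀₁; x₁₀/d, x₁₁]` is integral and congruent to `1` modulo `M`.
[cite: CalegariDimitrovTang2025, §4.3 (first paragraph) and §4.2 (4.3.3)] -/
theorem Gamma_mul_le_conjGL (hA : (A : Matrix (Fin 2) (Fin 2) ℝ) = !![(d : ℝ), 0; 0, 1])
    (hd : d ≠ 0) (M : ℕ) : Gamma (M * d) ≤ conjGL (Gamma M) A := by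
  intro x hx
  obtain ⟨h00, h01, h10, h11⟩ := Gamma_mem.mp hx
  have hMd : ((M * d : ℕ) : ℤ) ∣ x 1 0 := (ZMod.intCast_zmod_eq_zero_iff_dvd _ _).mp h10
  have hMd01 : ((M * d : ℕ) : ℤ) ∣ x 0 1 := (ZMod.intCast_zmod_eq_zero_iff_dvd _ _).mp h01
  have hMd00 : ((M * d : ℕ) : ℤ) ∣ x 0 0 - 1 := by
    rw [← ZMod.intCast_zmod_eq_zero_iff_dvd, Int.cast_sub, Int.cast_one, h00, sub_self]
  have hMd11 : ((M * d : ℕ) : ℤ) ∣ x 1 1 - 1 := by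
    rw [← ZMod.intCast_zmod_eq_zero_iff_dvd, Int.cast_sub, Int.cast_one, h11, sub_self]
  obtain ⟨c, hc⟩ : (d : ℤ) ∣ x 1 0 := (Dvd.intro_left (M : ℤ) (by push_cast; ring)).trans hMd
  have hdet : x 0 0 * x 1 1 - ((d : ℤ) * x 0 1) * c = 1 := by
    have h := Matrix.SpecialLinearGroup.det_coe x
    rw [Matrix.det_fin_two, hc] at h
    linear_combination h
  let y : SL(2, ℤ) := ⟨!![x 0 0, (d : ℤ) * x 0 1; c, x 1 1], by
    rw [Matrix.det_fin_two_of]; linear_combination hdet⟩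
  refine mem_conjGL.mpr ⟨y, ?_, ?_⟩
  · -- `y ∈ Γ(M)`
    rw [Gamma_mem]
    have hM00 : ((M : ℕ) : ℤ) ∣ x 0 0 - 1 := (Dvd.intro (d : ℤ) (by push_cast; ring)).trans hMd00
    have hM11 : ((M : ℕ) : ℤ) ∣ x 1 1 - 1 := (Dvd.intro (d : ℤ) (by push_cast; ring)).trans hMd11
    have hM01 : ((M : ℕ) : ℤ) ∣ (d : ℤ) * x 0 1 :=
      ((Dvd.intro (d : ℤ) (by push_cast; ring)).trans hMd01).trans (dvd_mul_left _ _)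
    have hMc : ((M : ℕ) : ℤ) ∣ c := by
      have hd' : (d : ℤ) ≠ 0 := by exact_mod_cast hd
      have : ((M : ℕ) : ℤ) * d ∣ d * c := by
        rw [← hc]; exact_mod_cast hMd
      rw [mul_comm ((M : ℕ) : ℤ)] at this
      exact (mul_dvd_mul_iff_left hd').mp this
    refine ⟨?_, ?_, ?_, ?_⟩
    · have := (ZMod.intCast_zmod_eq_zero_iff_dvd _ M).mpr hM00
      rw [Int.cast_sub, Int.cast_one, sub_eq_zero] at this
      simpa [y] using this
    · simpa [y] using (ZMod.intCast_zmod_eq_zero_iff_dvd _ M).mpr hM01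
    · simpa [y] using (ZMod.intCast_zmod_eq_zero_iff_dvd _ M).mpr hMc
    · have := (ZMod.intCast_zmod_eq_zero_iff_dvd _ M).mpr hM11
      rw [Int.cast_sub, Int.cast_one, sub_eq_zero] at this
      simpa [y] using this
  · have h : A * mapGL ℝ x = mapGL ℝ y * A :=
      diag_mul_mapGL_eq (y := y) (x := x) hA (by simp [y]) (by simp [y]) (by simp [y, hc])
        (by simp [y])
    rw [eq_mul_inv_iff_mul_eq]
    exact h.symm

/-- `conjGL` is monotone in the subgroup. [folklore] -/
private theorem conjGL_mono {Γ Γ' : Subgroup SL(2, ℤ)} (h : Γ ≤ Γ') (g : GL (Fin 2) ℝ) :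
    conjGL Γ g ≤ conjGL Γ' g := fun _ hx ↦ by
  obtain ⟨y, hy, e⟩ := mem_conjGL.mp hx
  exact mem_conjGL.mpr ⟨y, h hy, e⟩

/-! ### §2. Dilates of generators of `M_M` are generators of `M_{Md}` -/

/-- **The dilate of a generator of `M_M` is a generator of `M_{Md}`.** For `G ⊇ Γ(M)` of finite
index, `F ∈ M_{12m}(G)` with `F ∈ ℤ⟦q_M⟧` and `A = diag(d, 1)`: `F(dτ)` is a weight-`12m` form on
`A⁻¹ G A ∩ SL₂(ℤ) ⊇ Γ(M d)` with `F(dτ) ∈ ℤ⟦q_{Md}⟧`, so `F(dτ)/Δᵐ ∈ levelGens (M d)`.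
[cite: CalegariDimitrovTang2025, §4.3 (first paragraph: "`f(τ/p)` … is also a modular form with
integer coefficients"), §4.2 (4.3.3)] -/
theorem exists_dilate_mem_levelGens (hA : (A : Matrix (Fin 2) (Fin 2) ℝ) = !![(d : ℝ), 0; 0, 1])
    (hd : 0 < d) {M : ℕ} (hM : 0 < M) {G : Subgroup SL(2, ℤ)} [G.FiniteIndex] (hG : Gamma M ≤ G)
    {m : ℕ} (F : ModularForm (G : Subgroup (GL (Fin 2) ℝ)) (12 * (m : ℤ)))
    (hint : ∀ n : ℕ, ∃ z : ℤ, PowerSeries.coeff n (qExpansion (M : ℝ) F) = (z : ℂ)) :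
    ∃ g : ModularForm ((conjGL G A : Subgroup SL(2, ℤ)) : Subgroup (GL (Fin 2) ℝ)) (12 * (m : ℤ)),
      (∀ τ, g τ = F (A • τ)) ∧ algebraMap hol Mer (modFun m g) ∈ levelGens (M * d) := by
  haveI := finiteIndex_conjGL_of_coe_eq_diag G hA
  obtain ⟨g, hg⟩ := exists_modularForm_conjGL_apply_diag_smul F hA
  have hTM : T ^ M ∈ G := by
    refine hG ?_
    have h := CongruenceSubgroup.ModularGroup_T_pow_mem_Gamma M M dvd_rfl
    rwa [Int.natAbs_natCast, zpow_natCast] at h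
  have hper : ((M : ℕ) : ℝ) ∈ ((G : Subgroup SL(2, ℤ)) : Subgroup (GL (Fin 2) ℝ)).strictPeriods :=
    mem_strictPeriods_of_T_pow_mem hTM
  have hper' := mem_strictPeriods_conjGL_of_mem hA hper
  have hgint : ∀ n : ℕ, ∃ z : ℤ, PowerSeries.coeff n (qExpansion (M : ℝ) g) = (z : ℂ) :=
    forall_coeff_qExpansion_of_apply_diag_smul hA F g hg (Nat.cast_pos.mpr hM) hper hper'
      (P := fun x : ℂ ↦ ∃ z : ℤ, x = (z : ℂ)) ⟨0, by simp⟩ hint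
  have hgint' : ∀ n : ℕ, ∃ z : ℤ,
      PowerSeries.coeff n (qExpansion ((M * d : ℕ) : ℝ) g) = (z : ℂ) := fun n ↦ by
    have := forall_coeff_qExpansion_natMul g (h := (M : ℝ)) (Nat.cast_pos.mpr hM) hper'
      hd.ne' (P := fun x : ℂ ↦ ∃ z : ℤ, x = (z : ℂ)) ⟨0, by simp⟩ hgint n
    simpa only [Nat.cast_mul, mul_comm (d : ℝ)] using this
  exact ⟨g, hg, conjGL G A, inferInstance, m, g,
    (Gamma_mul_le_conjGL hA hd.ne' M).trans (conjGL_mono hG A), hgint', rfl⟩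

/-! ### §3. `λ(dτ) ∈ M_{2d}` -/

/-- `τ ↦ A • τ` is holomorphic for `A = diag(d, 1)`, `d > 0`. [folklore] -/
private theorem mdifferentiable_diag_smul
    (hA : (A : Matrix (Fin 2) (Fin 2) ℝ) = !![(d : ℝ), 0; 0, 1]) (hd : 0 < d) :
    MDiff (fun τ : ℍ ↦ A • τ) := by
  refine UpperHalfPlane.mdifferentiable_smul ?_
  rw [Matrix.GeneralLinearGroup.val_det_apply, hA, Matrix.det_fin_two_of]
  simp only [mul_one, mul_zero, sub_zero]
  exact_mod_cast hd

/-- ★ **`λ(dτ) ∈ M_{2d}`** [cite: CalegariDimitrovTang2025, §4.2 (4.3.3) (function field of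
`Y(2d)` over that of `Y(2)`)]: for `d > 0` and `A = diag(d, 1)`, the holomorphic function
`τ ↦ λ(A • τ) = λ(dτ)` — as an element of `𝓗` — lies in `levelField (2 d)`: with
`U⁶, W U⁵ ∈ M_12(Γ(2))` integral, `λ(dτ) = 1 − (W U⁵)(dτ)/Δ ⁄ (U⁶)(dτ)/Δ` and both quotients are
generators of `M_{2d}` (`exists_dilate_mem_levelGens`). -/
theorem exists_modularLambda_dilate_mem_levelField
    (hA : (A : Matrix (Fin 2) (Fin 2) ℝ) = !![(d : ℝ), 0; 0, 1]) (hd : 0 < d) :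
    ∃ Λ : hol, (Λ : ℍ → ℂ) = (fun τ : ℍ ↦ modularLambda ((A • τ : ℍ) : ℂ)) ∧
      algebraMap hol Mer Λ ∈ levelField (2 * d) := by
  obtain ⟨FB, FA, hB, hA', hBint, hAint⟩ := exists_thetaU_pow_six_and_thetaW_mul
  haveI : (Gamma 2).FiniteIndex := inferInstance
  obtain ⟨gB, hgB, hgBmem⟩ := exists_dilate_mem_levelGens hA hd two_pos (G := Gamma 2) le_rfl FB hBint
  obtain ⟨gA, hgA, hgAmem⟩ := exists_dilate_mem_levelGens hA hd two_pos (G := Gamma 2) le_rfl FA hAint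
  have hmdiff : MDiff fun τ : ℍ ↦ modularLambda ((A • τ : ℍ) : ℂ) :=
    (ModularLambda.mdifferentiable_of_differentiableAt fun z hz ↦
      differentiableAt_modularLambda hz).comp (mdifferentiable_diag_smul hA hd)
  let Λ : hol := ⟨fun τ : ℍ ↦ modularLambda ((A • τ : ℍ) : ℂ), (mem_hol).mpr hmdiff⟩
  refine ⟨Λ, rfl, ?_⟩
  have hBmem : algebraMap hol Mer (modFun 1 gB) ∈ levelField (2 * d) :=
    IntermediateField.subset_adjoin ℂ _ hgBmem
  have hAmem : algebraMap hol Mer (modFun 1 gA) ∈ levelField (2 * d) :=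
    IntermediateField.subset_adjoin ℂ _ hgAmem
  -- `U⁶(dτ)/Δ ≠ 0`
  have hB0 : algebraMap hol Mer (modFun 1 gB) ≠ 0 := by
    rw [map_ne_zero_iff _ algebraMap_hol_injective]
    intro h0
    have := congrArg (fun f : hol ↦ (f : ℍ → ℂ) UpperHalfPlane.I) h0
    simp only [modFun_apply, hgB, hB, Pi.pow_apply, Subalgebra.coe_zero, Pi.zero_apply,
      div_eq_zero_iff, pow_eq_zero_iff', thetaU_ne_zero, ModularForm.discriminant_ne_zero, ne_eq,
      false_and, or_self] at this
  -- `U⁶(dτ)/Δ · (1 − λ(dτ)) = (W U⁵)(dτ)/Δ` in `𝓗`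
  have hmul : algebraMap hol Mer (modFun 1 gB) * (1 - algebraMap hol Mer Λ) =
      algebraMap hol Mer (modFun 1 gA) := by
    rw [← map_one (algebraMap hol Mer), ← map_sub, ← map_mul]
    congr 1
    apply Subtype.ext
    funext τ
    have hU : thetaU (A • τ) ≠ 0 := thetaU_ne_zero _
    have hΔ : ModularForm.discriminant τ ≠ 0 := ModularForm.discriminant_ne_zero τ
    simp only [Λ, Subalgebra.coe_mul, Subalgebra.coe_sub, Subalgebra.coe_one, Pi.mul_apply,
      Pi.sub_apply, Pi.one_apply, modFun_apply, hgA, hgB, hA', hB, Pi.pow_apply, Pi.mul_apply,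
      one_sub_modularLambda (A • τ).im_pos, thetaW_apply, thetaU_apply]
    field_simp
  have hdiv : 1 - algebraMap hol Mer Λ =
      algebraMap hol Mer (modFun 1 gA) / algebraMap hol Mer (modFun 1 gB) := by
    rw [eq_div_iff hB0, mul_comm]
    exact hmul
  rw [show algebraMap hol Mer Λ = 1 - (1 - algebraMap hol Mer Λ) by ring, hdiv]
  exact sub_mem (one_mem _) (div_mem hAmem hBmem)

end UnboundedDenominators

end Literature.NumberTheory.Automorphic

end
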